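import Summits.QuantumAdvantage.AdviceFreeQNC0.DWalkFibres
import HarnessLib

/-!
# Cell qa-qnc0 (rung F-Q2-odd, `p = 3`): the STRUCTURED window word (ROUND-15 §3.5, the laws `ν^±`)

Planner qa-qnc0-p1 g16, `ROUND-15.md` §3.5 ("STRUCTURED LAWS": `β_j = λ(c_{j1})⋯λ(c_{jk})·r·λ'(c_{jk})⋯λ'(c_{j1})`,
`λ(c) = (r|f) f f`, `λ'(c) = f (r|f) f`), for THEOREM A′ `PredHardDWB3`.  With a constant weight `κ₀` the letters are
`rot = (1, κ₀)` (bit `1`) and the reflection `f = (−1, −κ₀)` (bit `0`); a parity gadget on `ℓ` bits `c` is the nested word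
`gbits (ℓ+1) c = [¬c₀, f, f] ++ gbits ℓ (c ∘ succ) ++ [f, ¬c₀, f]`, `gbits 0 = [rot]`.  PROVED (pure `IsAff` algebra, no
inverses): since `f f = 1` and `f·ℓ(c₀)·f = ℓ(c₀)⁻¹`, the gadget is the conjugate of `rot` by `Π ℓ(c_i)`, i.e.

* `isAff_gbits` — `wp(gbits ℓ c) = (1, κ₀·gsign c)` with `gsign c = Π_i ỹ(¬c_i) = (−1)^{#\{i : c_i\}}` (`gsign_eq_ite`);
* `isAff_gcat` — `K` gadgets in a row (`gcat`, block `j` reads `cb j`) give `(1, κ₀·Σ_{j<K} gsign (cb j))`;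
* `isAff_sword` — followed by a filler `fb` with `blockPerm κ₀ fb = P`, `P = (e, τ)` affine: the whole structured word
  `sword` is `(e, κ₀·Σ_j gsign (cb j) + τ)`;
* `gbits_shape` — every bit of a gadget is a constant or a negated input bit (coordinate degree `≤ 1` downstream).

WHAT THIS IS NOT: the embedding into patterns and the Smolensky step are the next file; separation NOT moved.
-/

noncomputable section

namespace Summit.QuantumAdvantage.AdviceFreeQNC0

namespace DWalk

open Finset Equiv

section Structured

variable (κ₀ : ZMod 3)

/-- The parity gadget on `ℓ` bits, as an ℕ-indexed bit sequence of length `6ℓ + 1` (junk beyond). -/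
def gbits : (ℓ : ℕ) → (Fin ℓ → Bool) → ℕ → Bool
  | 0, _, _ => true
  | ℓ + 1, c, s =>
    if s = 0 then !c 0
    else if s < 3 then false
    else if s < 3 + (6 * ℓ + 1) then gbits ℓ (fun i => c i.succ) (s - 3)
    else if s = 6 * ℓ + 5 then !c 0 else false

/-- The sign of the gadget's conjugator: `Π_i ỹ(¬c_i)`. -/
def gsign : (ℓ : ℕ) → (Fin ℓ → Bool) → ZMod 3
  | 0, _ => 1
  | ℓ + 1, c => yt (!c 0) * gsign ℓ (fun i => c i.succ)

/-- `gsign c = (−1)^{#{i : c_i = 1}}`. -/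
theorem gsign_eq_ite : ∀ (ℓ : ℕ) (c : Fin ℓ → Bool),
    gsign ℓ c = if (univ.filter fun i => c i = true).card % 2 = 1 then -1 else 1
  | 0, c => by simp [gsign]
  | ℓ + 1, c => by
    have key : ∀ (b : Bool) (N : ℕ), yt (!b) * (if N % 2 = 1 then (-1 : ZMod 3) else 1) =
        if (if b = true then N + 1 else N) % 2 = 1 then -1 else 1 := by
      intro b N
      rcases Nat.mod_two_eq_zero_or_one N with h | h <;> cases b
      · simp [yt, h]
      · have h1 : (N + 1) % 2 = 1 := by omega
        simp [yt, h, h1]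
      · simp [yt, h]
      · have h1 : (N + 1) % 2 = 0 := by omega
        simp [yt, h, h1]
    rw [gsign, gsign_eq_ite ℓ, Fin.card_filter_univ_succ (p := fun i => c i = true)]
    exact key (c 0) _

/-- `gsign` is `±1`. -/
theorem gsign_sq (ℓ : ℕ) (c : Fin ℓ → Bool) : gsign ℓ c * gsign ℓ c = 1 := by
  rw [gsign_eq_ite]; split_ifs <;> decide

variable {κ₀}

/-- Affine data with rewritten components. -/
theorem IsAff.congr {P : Perm (ZMod 3)} {e t e' t' : ZMod 3} (h : IsAff P e t) (he : e = e') (ht : t = t') :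
    IsAff P e' t' := by subst he; subst ht; exact h

/-- Three explicit letters: `[ℓ(c₀), f, f] = (ỹ, κ₀ỹ)`. -/
private theorem isAff_head (x : ℕ → Bool) {a : ℕ} (h1 : x (a + 1) = false) (h2 : x (a + 2) = false) :
    IsAff (wp (fun _ => κ₀) x a 3) (yt (x a)) (κ₀ * yt (x a)) := by
  refine (isAff_wp (fun _ => κ₀) x a 3).congr ?_ ?_
  · simp only [sgnW_succ, sgnW_zero, Nat.add_zero, h1, h2, one_mul]
    have : yt false = -1 := rfl
    rw [this]; ring
  · simp only [trW_succ, trW_zero, sgnW_succ, sgnW_zero, Nat.add_zero, h1, h2, one_mul, zero_add]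
    have : yt false = -1 := rfl
    rw [this]; ring

/-- Three explicit letters: `[f, ℓ(c₀), f] = (ỹ, −κ₀)`. -/
private theorem isAff_tail (x : ℕ → Bool) {a : ℕ} (h0 : x a = false) (h2 : x (a + 2) = false) :
    IsAff (wp (fun _ => κ₀) x a 3) (yt (x (a + 1))) (-κ₀) := by
  refine (isAff_wp (fun _ => κ₀) x a 3).congr ?_ ?_
  · simp only [sgnW_succ, sgnW_zero, Nat.add_zero, h0, h2, one_mul]
    have : yt false = -1 := rfl
    rw [this]; ring
  · simp only [trW_succ, trW_zero, sgnW_succ, sgnW_zero, Nat.add_zero, h0, h2, one_mul, zero_add]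
    have hf : yt false = -1 := rfl
    rw [hf]; ring

/-- **The gadget is `(1, κ₀·gsign c)`** (conjugate of `rot` by `Π ℓ(c_i)`). -/
theorem isAff_gbits : ∀ (ℓ : ℕ) (c : Fin ℓ → Bool),
    IsAff (wp (fun _ => κ₀) (gbits ℓ c) 0 (6 * ℓ + 1)) 1 (κ₀ * gsign ℓ c)
  | 0, c => by
    refine (isAff_wp _ _ 0 1).congr ?_ ?_ <;> simp [sgnW_succ, trW_succ, gbits, gsign, yt]
  | ℓ + 1, c => by
    have hsplit : 6 * (ℓ + 1) + 1 = 3 + ((6 * ℓ + 1) + 3) := by ring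
    rw [hsplit, wp_add, wp_add]
    -- the three pieces
    have hA : IsAff (wp (fun _ => κ₀) (gbits (ℓ + 1) c) 0 3) (yt (!c 0)) (κ₀ * yt (!c 0)) := by
      have h := isAff_head (κ₀ := κ₀) (gbits (ℓ + 1) c) (a := 0) (by simp [gbits]) (by simp [gbits])
      simpa [gbits] using h
    have hB : IsAff (wp (fun _ => κ₀) (gbits (ℓ + 1) c) (0 + 3) (6 * ℓ + 1)) 1
        (κ₀ * gsign ℓ (fun i => c i.succ)) := by
      rw [wp_congr (κ' := fun _ => κ₀) (x' := gbits ℓ (fun i => c i.succ)) (a' := 0) (fun t ht => ⟨rfl, ?_⟩)]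
      · exact isAff_gbits ℓ _
      · simp only [gbits, Nat.zero_add]
        rw [if_neg (by omega), if_neg (by omega), if_pos (by omega), Nat.add_sub_cancel_left]
    have hC : IsAff (wp (fun _ => κ₀) (gbits (ℓ + 1) c) (0 + 3 + (6 * ℓ + 1)) 3) (yt (!c 0)) (-κ₀) := by
      have e1 : gbits (ℓ + 1) c (0 + 3 + (6 * ℓ + 1)) = false := by
        simp only [gbits]; rw [if_neg (by omega), if_neg (by omega), if_neg (by omega), if_neg (by omega)]
      have e2 : gbits (ℓ + 1) c (0 + 3 + (6 * ℓ + 1) + 1) = !c 0 := by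
        simp only [gbits]; rw [if_neg (by omega), if_neg (by omega), if_neg (by omega), if_pos (by omega)]
      have e3 : gbits (ℓ + 1) c (0 + 3 + (6 * ℓ + 1) + 2) = false := by
        simp only [gbits]; rw [if_neg (by omega), if_neg (by omega), if_neg (by omega), if_neg (by omega)]
      have h := isAff_tail (κ₀ := κ₀) (gbits (ℓ + 1) c) (a := 0 + 3 + (6 * ℓ + 1)) e1 e3
      rwa [e2] at h
    refine ((hA.mul (hB.mul hC))).congr ?_ ?_
    · rw [one_mul, yt_mul_self]
    · rw [gsign]; ring

/-! ### Gadgets in a row, then a filler -/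

/-- `K` gadgets in a row: block `j` occupies positions `j(6ℓ+1) … (j+1)(6ℓ+1) − 1` and reads `cb j`. -/
def gcat (ℓ : ℕ) (cb : ℕ → Fin ℓ → Bool) (t : ℕ) : Bool := gbits ℓ (cb (t / (6 * ℓ + 1))) (t % (6 * ℓ + 1))

/-- **`K` gadgets give `(1, κ₀·Σ_{j<K} gsign (cb j))`.** -/
theorem isAff_gcat (ℓ : ℕ) (cb : ℕ → Fin ℓ → Bool) :
    ∀ K : ℕ, IsAff (wp (fun _ => κ₀) (gcat ℓ cb) 0 (K * (6 * ℓ + 1))) 1 (κ₀ * ∑ j ∈ range K, gsign ℓ (cb j))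
  | 0 => by simp [isAff_one]
  | K + 1 => by
    rw [Nat.succ_mul, wp_add]
    have hB : IsAff (wp (fun _ => κ₀) (gcat ℓ cb) (0 + K * (6 * ℓ + 1)) (6 * ℓ + 1)) 1 (κ₀ * gsign ℓ (cb K)) := by
      rw [wp_congr (κ' := fun _ => κ₀) (x' := gbits ℓ (cb K)) (a' := 0) (fun t ht => ⟨rfl, ?_⟩)]
      · exact isAff_gbits ℓ _
      · have hpos : 0 < 6 * ℓ + 1 := by omega
        simp only [gcat, Nat.zero_add]
        rw [Nat.add_comm, Nat.add_mul_div_right _ _ hpos, Nat.div_eq_of_lt ht, Nat.zero_add, Nat.add_mul_mod_self_right,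
          Nat.mod_eq_of_lt ht]
    refine ((isAff_gcat ℓ cb K).mul hB).congr (by ring) ?_
    rw [Finset.sum_range_succ]; ring

/-- The structured word: `K` gadgets, then a filler block `fb` of length `Lf`. -/
def sword (ℓ K : ℕ) (cb : ℕ → Fin ℓ → Bool) {Lf : ℕ} (fb : Fin Lf → Bool) (t : ℕ) : Bool :=
  if t < K * (6 * ℓ + 1) then gcat ℓ cb t else bN fb (t - K * (6 * ℓ + 1))

/-- **The structured word is `(e, κ₀·Σ_j gsign (cb j) + τ)`** when the filler realises `(e, τ)`. -/
theorem isAff_sword (ℓ K : ℕ) (cb : ℕ → Fin ℓ → Bool) {Lf : ℕ} (fb : Fin Lf → Bool) {e τ : ZMod 3}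
    (hfb : IsAff (blockPerm κ₀ fb) e τ) :
    IsAff (wp (fun _ => κ₀) (sword ℓ K cb fb) 0 (K * (6 * ℓ + 1) + Lf)) e
      (κ₀ * (∑ j ∈ range K, gsign ℓ (cb j)) + τ) := by
  rw [wp_add]
  have hA : IsAff (wp (fun _ => κ₀) (sword ℓ K cb fb) 0 (K * (6 * ℓ + 1))) 1 (κ₀ * ∑ j ∈ range K, gsign ℓ (cb j)) := by
    rw [wp_congr (κ' := fun _ => κ₀) (x' := gcat ℓ cb) (a' := 0) (fun t ht => ⟨rfl, by simp [sword, ht]⟩)]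
    exact isAff_gcat ℓ cb K
  have hB : IsAff (wp (fun _ => κ₀) (sword ℓ K cb fb) (0 + K * (6 * ℓ + 1)) Lf) e τ := by
    rw [wp_congr (κ' := fun _ => κ₀) (x' := bN fb) (a' := 0) (fun t ht => ⟨rfl, by
      simp only [sword, Nat.zero_add]; rw [if_neg (by omega), Nat.add_sub_cancel_left]⟩)]
    exact hfb
  refine (hA.mul hB).congr (one_mul e) (by ring)

/-! ### Every gadget bit is a constant or a negated input bit -/

/-- Shape of the gadget bits (for the degree bound of the structured embedding). -/
theorem gbits_shape : ∀ (ℓ : ℕ) (s : ℕ),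
    (∃ b₀ : Bool, ∀ c : Fin ℓ → Bool, gbits ℓ c s = b₀) ∨ (∃ i : Fin ℓ, ∀ c : Fin ℓ → Bool, gbits ℓ c s = !c i)
  | 0, s => Or.inl ⟨true, fun c => rfl⟩
  | ℓ + 1, s => by
    by_cases h0 : s = 0
    · exact Or.inr ⟨0, fun c => by simp [gbits, h0]⟩
    by_cases h3 : s < 3
    · exact Or.inl ⟨false, fun c => by simp only [gbits]; rw [if_neg h0, if_pos h3]⟩
    by_cases hin : s < 3 + (6 * ℓ + 1)
    · rcases gbits_shape ℓ (s - 3) with ⟨b₀, hb⟩ | ⟨i, hi⟩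
      · exact Or.inl ⟨b₀, fun c => by simp only [gbits]; rw [if_neg h0, if_neg h3, if_pos hin, hb]⟩
      · exact Or.inr ⟨i.succ, fun c => by simp only [gbits]; rw [if_neg h0, if_neg h3, if_pos hin, hi]⟩
    by_cases h5 : s = 6 * ℓ + 5
    · exact Or.inr ⟨0, fun c => by simp only [gbits]; rw [if_neg h0, if_neg h3, if_neg hin, if_pos h5]⟩
    · exact Or.inl ⟨false, fun c => by simp only [gbits]; rw [if_neg h0, if_neg h3, if_neg hin, if_neg h5]⟩

/-- Shape of the structured word's bits (`cb` built blockwise from a map `c ↦ cb c`): each position reads a constant or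
a negated bit `c (p j i)` of gadget `j = t / (6ℓ+1)`. -/
theorem sword_shape (ℓ K : ℕ) {Lf : ℕ} (fb : Fin Lf → Bool) (t : ℕ) :
    (∃ b₀ : Bool, ∀ cb : ℕ → Fin ℓ → Bool, sword ℓ K cb fb t = b₀) ∨
      (t < K * (6 * ℓ + 1) ∧ ∃ i : Fin ℓ, ∀ cb : ℕ → Fin ℓ → Bool, sword ℓ K cb fb t = !cb (t / (6 * ℓ + 1)) i) := by
  by_cases ht : t < K * (6 * ℓ + 1)
  · rcases gbits_shape ℓ (t % (6 * ℓ + 1)) with ⟨b₀, hb⟩ | ⟨i, hi⟩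
    · exact Or.inl ⟨b₀, fun cb => by simp [sword, ht, gcat, hb]⟩
    · exact Or.inr ⟨ht, i, fun cb => by simp [sword, ht, gcat, hi]⟩
  · exact Or.inl ⟨bN fb (t - K * (6 * ℓ + 1)), fun cb => by simp [sword, ht]⟩

end Structured

end DWalk

end Summit.QuantumAdvantage.AdviceFreeQNC0

end
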